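import Literature.NumberTheory.LFunctions.GranvilleMollinLinnikProofs
import Literature.NumberTheory.LFunctions.ExplicitFormulaPsiCharProofs
import HarnessLib

/-!
# Granville–Mollin (3.3) from (3.2) alone

Topic `Literature/NumberTheory/LFunctions`, sub-namespace `SiegelZero`. THEOREMS (everything
proved). With Montgomery–Vaughan's Theorem 12.10 now a theorem of the tree
(`Literature.NumberTheory.LFunctions.truncatedExplicitFormula_psiChar_holds`,
`ExplicitFormulaPsiCharProofs.lean`), the conditional deduction of Granville–Mollin's explicit
formula in the Linnik range (`Literature.NumberTheory.LFunctions.SiegelZero.GranvilleMollin2000_eq33`,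
`ExceptionalZeroPrimeSums.lean`) from its two analytic inputs
(`GranvilleMollin2000_eq33_of_explicitFormula_of_eq32`, `GranvilleMollinLinnikProofs.lean`) needs
only ONE remaining named fact: Granville–Mollin (3.2), i.e. Bombieri's log-free zero-density
estimate with the Deuring–Heilbronn factor
(`Literature.NumberTheory.LFunctions.GranvilleMollin2000_eq32`, `LinnikZeroSumBound.lean`).

* `GranvilleMollin2000_eq33_of_eq32 : GranvilleMollin2000_eq32 → GranvilleMollin2000_eq33`.

## References

* A. Granville, R. A. Mollin, *Rabinowitsch revisited*, Acta Arith. 96 (2000) 139–153, §3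
  (3.1)–(3.3). [GranvilleMollin2000]
* H. L. Montgomery, R. C. Vaughan, *Multiplicative Number Theory I*, CUP 2007, Theorem 12.10.
  [MontgomeryVaughan2007]
-/

noncomputable section

namespace Literature.NumberTheory.LFunctions.SiegelZero

/-- **Granville–Mollin (3.3) from (3.2)**: the explicit formula in the Linnik range
`∑_{p ≤ x} (d/p) log p + x^β/β ≪ x/(|d| log x) + x^{1 − c/log|d|}/η` (`x > |d|^C`, `C > 9`)
follows from Granville–Mollin's (3.2) (Bombieri's log-free zero-density estimate with the
Deuring–Heilbronn factor) alone, the other input (3.1) = Montgomery–Vaughan Theorem 12.10 being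
proved in the tree (`truncatedExplicitFormula_psiChar_holds`).
[cite: GranvilleMollin2000, §3 (3.1)–(3.3)] -/
theorem GranvilleMollin2000_eq33_of_eq32 (h : GranvilleMollin2000_eq32) : GranvilleMollin2000_eq33 :=
  GranvilleMollin2000_eq33_of_explicitFormula_of_eq32 truncatedExplicitFormula_psiChar_holds h

end Literature.NumberTheory.LFunctions.SiegelZero

end
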